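import Mathlib
import Summits.Ventures.HodgeRepro.Tier4.Target
import Summits.Ventures.HodgeRepro.Tier4.LitCompactness
import Summits.Ventures.HodgeRepro.Tier4.Line3.Defs
import Summits.Ventures.HodgeRepro.Tier4.Line3.LocaliserS
import Summits.Ventures.HodgeRepro.Tier4.Line3.TorusInvariance
import Summits.Ventures.HodgeRepro.Tier4.Line3.StableLattice
import Summits.Ventures.HodgeRepro.Tier4.Line3.StableLatticeU
import Summits.Ventures.HodgeRepro.Tier4.Line3.LatticeGaussDefs
import Summits.Ventures.HodgeRepro.Tier4.Line3.InvariantMajorantDef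
import Summits.Ventures.HodgeRepro.Tier4.Line3.InvariantClassBound
import Summits.Ventures.HodgeRepro.Tier4.Line3.InvariantRouteAssembly
import Summits.Ventures.HodgeRepro.Tier4.Line3.InvariantRouteFinal
import Summits.Ventures.HodgeRepro.Tier4.Line3.InvMajorantMass
import Summits.Ventures.HodgeRepro.Tier4.Line3.RayMinor
import Summits.Ventures.HodgeRepro.Tier4.Line3.RayClassBound
import Summits.Ventures.HodgeRepro.Tier4.Line3.CrossMinor
import Summits.Ventures.HodgeRepro.Tier4.Line3.FamilyClassBound
import Summits.Ventures.HodgeRepro.Tier4.Line3.OffSetMass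
import Summits.Ventures.HodgeRepro.Tier4.Line3.OffSetMassExp
import Summits.Ventures.HodgeRepro.Tier4.Line3.FamilyAssembly
import Summits.Ventures.HodgeRepro.Tier4.Line3.ScalarFamily
import Summits.Ventures.HodgeRepro.Tier4.Line3.RankOneInvariant
import Summits.Ventures.HodgeRepro.Tier4.Line3.GrowthOn

/-!
# Tier4/Line3/FamilyLit — L3.5″ OF RECORD: the summable majorant OFF THE SCALAR FAMILY from the per-slot clause,
the growth clause and `hlit`

Blind re-derivation cell `pub-hodge-repro`, Tier 4 «PROVE THE STEP» (README §9–§10), LINE L3, lemma L3.5″ (the cut of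
t4-plan-3 g3 S13492 (3)); seat t4-L2-p3 (gen 3).  The closing module of the family route:

* `term_dominated_crossFamily_lit`: `term_dominated_family` (FamilyAssembly) with its displayed `Γ`-stable support set
  and theta mass CONSUMED — t4-L2-p1's per-slot stable lattice (`exists_stable_lattice_suppSlot`, StableLatticeU),
  t4-x2's theta mass over `{nsq ≤ r₀}` (`exists_invMajorantDensity_le_of_nsq_le`, InvMajorantMass) and the
  Borel–Harish-Chandra fundamental domain `hlit` (the route's only printed input) — off the cross family;
* **`term_dominated_scalarFamily`**: the skeleton's signature (S13492 (3)) — off x2's semantic `ScalarFamily xm`: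
  off the rank-one ray (`= CrossFamily xm`, definitionally) by the cross-family bound; on the rank-one ray but off the
  scalar family every orbit has a ZERO SLOT (x2's `exists_zero_slot_of_mem_rankOneRay_not_mem_scalarFamily`, which
  needs the non-vanishing `hG` of the Gram entries of `xm`), so its term is `0` at every depth
  (x2's `term_eq_zero_of_zero_slot`) and the same bound serves.  (The tree name of this theorem is
  `term_dominated_scalarFamily` because `term_dominated_family` landed as the displayed form, p680029, before the
  cut line; the skeleton binds it by name.)

* **`term_dominated_scalarFamily_of_contentBound`**: the PRINT FORM — `GrowthInvOn` replaced by the three clauses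
  `LocSizeOn loc`, `RepDenomOn p loc`, `ContentBound D C e′` (GrowthOn's `growthInvOn_of_contentBound`).

The remaining hypotheses are clauses on the localiser `(level, loc)` — `SuppU4` (the per-slot support, x2's text of
record), the size and depth of the representatives — the content bound on the theta coefficients, the level clause
`hlev`, `hG`, `hab` and `hlit`.  No printed input is consumed beyond `hlit`; nothing here asserts anything about the
truth of (P); HC_CM is NOT proved by anyone in this repository.
-/

set_option autoImplicit false

noncomputable section

namespace Summit.Ventures.HodgeRepro.Tier4.Line3

open Summit.Ventures.HodgeRepro.Tier4
open Matrix MeasureTheory NumberField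
open scoped ENNReal

namespace T4Data

variable (X : T4Data)

/-- x2's rank-one ray is the cross family (the same definition). -/
theorem rankOneRay_eq_crossFamily (xm : X.Tuple) : X.RankOneRay xm = X.CrossFamily xm := rfl

/-- **L3.5 OFF THE CROSS FAMILY, CLOSED**: from `SuppSlot`, `GrowthInvOn`, the level clause and `hlit` — the
`Γ`-stable support lattice (t4-L2-p1) and the theta mass (t4-x2) consumed by name. -/
theorem term_dominated_crossFamily_lit (D : X.ThetaData)
    (p : IsDedekindDomain.HeightOneSpectrum (RingOfIntegers X.E)) (xm : X.Tuple)
    {level : ℕ → X.Level} (loc : ∀ N, X.Tr (level N))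
    (hlev : ∃ q₀ : ℕ, 1 ≤ q₀ ∧ ∀ N, X.Γ ∩ principalCongruence X.c X.H (q₀ ^ N) ⊆ (level N).1)
    (hsupp : X.SuppSlot D p xm loc) (hinv : X.GrowthInvOn D loc)
    (hlit : Lit.BorelHarishChandra1962_Thm11_8_fundamentalDomain_hdef X.E X.H X.τ₀ X.C) :
    ∃ bound : X.Orbit → ℝ, (∀ o, 0 ≤ bound o) ∧ Summable bound ∧
      ∀ N (o : X.Orbit), o ∉ X.CrossFamily xm → ‖X.term D.Φ D.cf (level N) (loc N) o‖ ≤ bound o := by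
  -- the relatively compact fundamental domain of `Γ`
  obtain ⟨F, hF, r₀, hr₀, hFr⟩ := hlit X.hHerm X.hAn X.hC X.hDef X.Γ X.hΓ
  -- the `Γ`-stable lattice containing the support (per slot)
  obtain ⟨d, hd, _, _, hstab, hsuppd⟩ := X.exists_stable_lattice_suppSlot D loc xm hsupp
  have hS : X.IsGammaStable (X.linesOf (X.denomLattice d)) := X.isGammaStable_linesOf hstab
  have hsuppIn : ∀ (N : ℕ) (w : X.LineTuple), X.coefQ D.cf (loc N) (X.rep w) ≠ 0 →
      w ∈ X.linesOf (X.denomLattice d) := by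
    intro N w hc
    obtain ⟨l, x, _, hx, hl, hball⟩ := hsuppd N w hc
    refine ⟨x, hx, fun j => ?_⟩
    have h1 : x j - l j • xm j ∈ X.denomLattice d := Submodule.smul_le_right (hball j)
    have h3 : x j = (x j - l j • xm j) + l j • xm j := by abel
    rw [h3]
    exact (X.denomLattice d).add_mem h1 (hl j)
  -- the theta mass of the invariant majorant over `F`
  have hmass : ∀ e c₁ : ℝ, 0 < c₁ → ∃ M_F : ℝ, 0 ≤ M_F ∧
      ∫⁻ z in F, X.invMajorantDensity D (X.linesOf (X.denomLattice d)) xm e c₁ z ≤ ENNReal.ofReal M_F := by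
    intro e c₁ hc₁
    obtain ⟨A, hA, hbound⟩ := X.exists_invMajorantDensity_le_of_nsq_le D p hd xm e hc₁ hr₀
    refine ⟨A * (volume (ball : Set (Fin 2 → ℂ))).toReal, mul_nonneg hA ENNReal.toReal_nonneg, ?_⟩
    exact lintegral_le_of_le_on hF.1 hF.2.1 hA fun z hz => hbound z (hFr z hz)
  exact X.term_dominated_family D p xm loc hlev hsupp hinv hS hsuppIn hF hmass

/-- **L3.5″ OF RECORD (t4-plan-3 g3 S13492 (3))**: for a family of translates with the per-slot support clause and the
growth clause, a centre `xm` with independent first two slots and non-zero Gram entries, the level clause and the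
Borel–Harish-Chandra fundamental domain, the orbital terms OFF THE SCALAR FAMILY have one summable majorant, uniform
in the depth. -/
theorem term_dominated_scalarFamily (D : X.ThetaData) {p : IsDedekindDomain.HeightOneSpectrum (RingOfIntegers X.E)}
    {xm : X.Tuple} (hab : LinearIndependent X.E ![xm 0, xm 1]) (hG : ∀ i j, X.gram xm i j ≠ 0)
    {level : ℕ → X.Level} (loc : ∀ N, X.Tr (level N))
    (hsupp : X.SuppU4 D p xm loc) (hinv : X.GrowthInvOn D loc)
    (hlev : ∃ q₀ : ℕ, 1 ≤ q₀ ∧ ∀ N, X.Γ ∩ principalCongruence X.c X.H (q₀ ^ N) ⊆ (level N).1)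
    (hlit : Lit.BorelHarishChandra1962_Thm11_8_fundamentalDomain_hdef X.E X.H X.τ₀ X.C) :
    ∃ bound : X.Orbit → ℝ, (∀ o, 0 ≤ bound o) ∧ Summable bound ∧
      ∀ N (o : X.Orbit), o ∉ X.ScalarFamily xm → ‖X.term D.Φ D.cf (level N) (loc N) o‖ ≤ bound o := by
  have _hab := hab
  obtain ⟨bound, h0, hsum, hb⟩ := X.term_dominated_crossFamily_lit D p xm loc hlev hsupp hinv hlit
  refine ⟨bound, h0, hsum, fun N o ho => ?_⟩
  by_cases hR : o ∈ X.RankOneRay xm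
  · -- on the rank-one ray but off the scalar family: a zero slot, the term is `0`
    obtain ⟨x, hxo, j, hj⟩ := X.exists_zero_slot_of_mem_rankOneRay_not_mem_scalarFamily xm hG hR ho
    have h : X.term D.Φ D.cf (level N) (loc N) o = 0 := by
      rw [← hxo]
      exact X.term_eq_zero_of_zero_slot D x j hj (level N) (loc N)
    rw [h, norm_zero]
    exact h0 o
  · exact hb N o hR

/-- **L3.5″ IN THE PRINT'S FORM**: the summable majorant off the scalar family from the per-slot support clause, the
size and depth of the localiser's representatives, the content bound on the theta coefficients, the level clause and
the Borel–Harish-Chandra fundamental domain. -/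
theorem term_dominated_scalarFamily_of_contentBound (D : X.ThetaData)
    {p : IsDedekindDomain.HeightOneSpectrum (RingOfIntegers X.E)}
    {xm : X.Tuple} (hab : LinearIndependent X.E ![xm 0, xm 1]) (hG : ∀ i j, X.gram xm i j ≠ 0)
    {level : ℕ → X.Level} (loc : ∀ N, X.Tr (level N))
    (hsupp : X.SuppU4 D p xm loc) (hsize : X.LocSizeOn loc) (hrep : X.RepDenomOn p loc)
    {C e' : ℝ} (hC : 0 ≤ C) (he' : 0 ≤ e') (hcf : X.ContentBound D C e')
    (hlev : ∃ q₀ : ℕ, 1 ≤ q₀ ∧ ∀ N, X.Γ ∩ principalCongruence X.c X.H (q₀ ^ N) ⊆ (level N).1)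
    (hlit : Lit.BorelHarishChandra1962_Thm11_8_fundamentalDomain_hdef X.E X.H X.τ₀ X.C) :
    ∃ bound : X.Orbit → ℝ, (∀ o, 0 ≤ bound o) ∧ Summable bound ∧
      ∀ N (o : X.Orbit), o ∉ X.ScalarFamily xm → ‖X.term D.Φ D.cf (level N) (loc N) o‖ ≤ bound o :=
  X.term_dominated_scalarFamily D hab hG loc hsupp (X.growthInvOn_of_contentBound D p loc hsize hrep hC he' hcf)
    hlev hlit

end T4Data

end Summit.Ventures.HodgeRepro.Tier4.Line3

end
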